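import Summits.HodgeConjecture.HodgeConjecture.Theorems.R90S2ArchKitHDefs                   -- ★ S2 `H_∞`-KIT DEFINITIONS OF RECORD (P-4, ED. 3a): `CptPlace`, `HInfExt`, `HInfExt.xiOnly`, `PktInfH`, `HLabIota`, `rogawskiArchKitH`, `HInfExt.LawKH5`, `HInfExt.LawKT3`, `isEmpty_cptPlace_of_licensed_xiOnly` (+ ★ `F0P3XiArchDataOfRecord`: `nCompactOfRecord`, `one_le_nCompactOfRecord`, `nCompactOfRecord_eq_card_ne_infinitePlace`)
import HarnessLib

/-!
# R90-TF ∕ S2 «Ch11-arch» — THE `H_∞`-KIT WITH LICENSED COMPACT ROWS: `HInfExt.ofCptRows`, its vacuous law-shares, and the ON-PATH EMPTINESS CERTIFICATE for `xiOnly`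

Cell `hodgecm-mathlib`, programme R90-TF, section S2 (dealer K2E1b-plan (g7): DEAL «S2-σ13» BRICK 2 2026-09-04T21:57:11Z and RULING S2-R15 «Q-S1 CONSEQUENCE
FOR THE H∞-BLOCK: `xiOnly` IS EMPTY ON PATH; ED. 3 GOES PARAMETRIC; D-S2-6 PROMOTED TO ON-PATH» 21:57:56Z, items (2)–(3)); pen K2E3-p23 (g7) (`--kind definition
--supports stmt-HodgeConjecture-24833 --as helper`); crux H413 = `stmt-HodgeConjecture-24833` (supports-only, closes nothing).  The Lean spine of S2-R15 (2)–(3):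
independent of hole D-S2-6 (`onesCompatRow`, hand «E1b-D-S2-6» `Theorems/K2E1bOnesCompatRowsOfRecord.lean`), which will INSTANTIATE `ofCptRows` below.

CONTENT.
* §1 `HInfExt.ofCptRows L ι R s : HInfExt L ι` — the extension datum with NO extension labels ∕ tokens (like ★ `HInfExt.xiOnly`) but with LICENSED one-dimensional
  `H_w`-data `R w : Finset (ℤ × ℤ)` (exponent pairs `(eη_w, eψ_w)`) and signs `s w` at every compact place `w ≠ w(ι)`; `rfl` read-backs; `ofCptRows_empty :
  ofCptRows (fun _ => ∅) (fun _ _ => 0) = xiOnly` (`rfl`).  The instance of record on path (S2-R15 (3)) will be `xiRows μω := ofCptRows (onesCompatRow L ι μω)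
  (fun w κ => if κ ∈ onesCompatRow L ι μω w then -1 else 0)` once D-S2-6 names `onesCompatRow`.
* §2 the extension's law-shares are VACUOUS for `ofCptRows` (no extension token ∕ label): `ofCptRows_lawKH5`, `ofCptRows_lawKT3` (binders spelled verbatim as ★
  `HInfExt.LawKT3` :374–:381), and `xiOnly_lawKT3` (the (KT3) twin of ★ `HInfExt.xiOnly_lawKH5`).
* §3 THE ON-PATH EMPTINESS CERTIFICATE (S2-R15 FACT): `card_cptPlace : #(CptPlace L ι) = nCompactOfRecord L` (★ `nCompactOfRecord_eq_card_ne_infinitePlace`);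
  `nonempty_cptPlace_of_one_lt_card`, `nonempty_cptPlace_of_two_le_finrank (h2 : 2 ≤ [L⁺:ℚ])` (★ `one_le_nCompactOfRecord`); `isEmpty_licensed_xiOnly`,
  **`isEmpty_pktInfH_xiOnly [Nonempty (CptPlace L ι)] : IsEmpty (PktInfH L ι xiOnly)`** (★ `isEmpty_cptPlace_of_licensed_xiOnly`), its `[L⁺:ℚ] ≥ 2`, `[L⁺:ℚ] ≥ 3`
  (R-QS1-7 token `h3`) and kit-level forms — at `X := xiOnly` the `H_∞`-kit of record has NO packet on the h413 path, so every packet law over it is vacuous there.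
* §4 NON-EMPTINESS FOR LICENSED ROWS: `nonempty_licensed_ofCptRows`, **`nonempty_pktInfH_ofCptRows (hR : ∀ w, (R w).Nonempty) : Nonempty (PktInfH L ι (ofCptRows R s))`**
  (witness: the character packet `ξ_ι(0,0) ⊗ (a chosen licensed row at each compact place)`), the criterion `nonempty_pktInfH_ofCptRows_iff`, and the converse
  `isEmpty_pktInfH_ofCptRows_of_eq_empty` (one compact place licensing nothing empties the kit).  (Cross-checked against K2E1-p11 (g3)'s independent cut
  `K2/K2E1-p11/g3/R90S2ArchKitHRowsDefs.lean` 0f87012aede8dcf8, 2026-09-04T22:03:55Z — same heads modulo names; his `h3` and `iff` forms lifted here.)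

HONEST LABEL: HC_CM is proved only modulo the 7 printed citations (2 remaining named inputs: hLiu418 = `stmt-HodgeConjecture-24832`, h413 =
`stmt-HodgeConjecture-24833`) until rung 0 closes; definitions and read-backs close nothing; count-neutral.  ZERO `sorry`; no `instance`, no `notation`∕`macro`,
no local-instance attribute, no attribute removed; default heartbeats.

References: [Rogawski1990] §12.3 pp. 176–178 (Props. 12.3.2, 12.3.3), §13.3 pp. 202–203, §14.4 Prop. 14.4.2 p. 236 (the one-dimensional `H_w`-data at the
compact places and their signs), §14.6 pp. 242–244 (`N = Card(S₀)`); [Knapp1986] Thm. 10.2.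
-/

set_option autoImplicit false
-- the mandated namespace repeats the single-problem summit's segment (`HodgeConjecture.HodgeConjecture`)
set_option linter.dupNamespace false

noncomputable section

open MeasureTheory MeasureTheory.Measure NumberField
open scoped Classical

namespace Summit.HodgeConjecture.HodgeConjecture.R90.S2

open Literature.NumberTheory Literature.NumberTheory.Automorphic Literature.NumberTheory.Automorphic.UnitaryGroup
open Literature.NumberTheory.Rogawski1990 Literature.NumberTheory.GaloisRepresentations
open Literature.RepresentationTheory
open Literature.RepresentationTheory.BorelWallach2000 Literature.RepresentationTheory.KonnoKonno2007 Literature.RepresentationTheory.KonnoKonno2007.RealDualPair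
open Literature.RepresentationTheory.KonnoKonno2007.RealDualPair.UForm
open Summit.HodgeConjecture.HodgeConjecture.Cruxes.H413
open Summit.HodgeConjecture.HodgeConjecture.Cruxes.H413.F0P3InnerFormClassificationV6 (Gp Places Cinf)
open Summit.HodgeConjecture.HodgeConjecture.Cruxes.H413.F0P3XiArchPacketOfRecord
open Summit.HodgeConjecture.HodgeConjecture.Cruxes.H413.F0P3XiArchDataOfRecord (archTypeOfRecord nCompactOfRecord one_le_nCompactOfRecord nCompactOfRecord_eq_card_ne_infinitePlace)
open Summit.HodgeConjecture.HodgeConjecture.Cruxes.H413.F0P3ArchPacketKit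
open Summit.HodgeConjecture.HodgeConjecture.Cruxes.H413.K2E1bCarriersOfRecord
open Summit.HodgeConjecture.HodgeConjecture.Cruxes.H413.K2E1bArchCharacterOfOneDim

/-! ## §1 The extension datum with licensed compact rows [§14.4 Prop. 14.4.2 p. 236; §12.3 p. 178] -/

/-- **`HInfExt.ofCptRows L ι R s`** — the extension datum with NO extension labels and NO extension tokens (both `PEmpty`, exactly as ★ `HInfExt.xiOnly`), whose
LICENSED one-dimensional `H_w`-data at the compact place `w ≠ w(ι)` are the exponent pairs `R w : Finset (ℤ × ℤ)` (place-indexed `(eη_w, eψ_w)` currency) with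
signs `s w : ℤ × ℤ → ℤ` relative to `Δ″_w` (Prop. 14.4.2 (c)-type; junk off `R w`).  S2-R15 (3): the instance of record on path is `ofCptRows (onesCompatRow L ι μω)
(sign −1 on the rows)` once hole D-S2-6 names the two `𝟙`-compatible character rows. [cite: Rogawski1990, §14.4 Prop. 14.4.2 p. 236; §12.3 p. 178] -/
def HInfExt.ofCptRows (L : Type) [Field L] [NumberField L] [IsCMField L] (ι : L →+* ℂ)
    (R : CptPlace L ι → Finset (ℤ × ℤ)) (s : CptPlace L ι → ℤ × ℤ → ℤ) : HInfExt L ι where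
  Lab := PEmpty
  Tok := PEmpty
  mem := fun r => nomatch r
  lift := fun r => nomatch r
  pair := fun r => nomatch r
  tr := fun t => nomatch t
  cptLab := R
  cptSign := s

section Frame

variable (L : Type) [Field L] [NumberField L] [IsCMField L] (ι : L →+* ℂ)
  (R : CptPlace L ι → Finset (ℤ × ℤ)) (s : CptPlace L ι → ℤ × ℤ → ℤ)

/-- Read-back (`rfl`): the licensed rows. [cite: Rogawski1990, §14.4 Prop. 14.4.2 p. 236] -/
@[simp] theorem HInfExt.ofCptRows_cptLab (w : CptPlace L ι) : (HInfExt.ofCptRows L ι R s).cptLab w = R w := rfl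

/-- Read-back (`rfl`): the signs. [cite: Rogawski1990, §14.4 Prop. 14.4.2 p. 236] -/
@[simp] theorem HInfExt.ofCptRows_cptSign (w : CptPlace L ι) (κ : ℤ × ℤ) : (HInfExt.ofCptRows L ι R s).cptSign w κ = s w κ := rfl

/-- `ofCptRows` has no extension label. [cite: Rogawski1990, §12.3 p. 178] -/
theorem HInfExt.isEmpty_lab_ofCptRows : IsEmpty (HInfExt.ofCptRows L ι R s).Lab :=
  ⟨fun r => nomatch r⟩

/-- `ofCptRows` has no extension token. [cite: Rogawski1990, §12.3 p. 178] -/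
theorem HInfExt.isEmpty_tok_ofCptRows : IsEmpty (HInfExt.ofCptRows L ι R s).Tok :=
  ⟨fun t => nomatch t⟩

/-- **`ofCptRows` with nothing licensed IS ★ `xiOnly`** (`rfl`): the print shell `d = 1` is the special case `R = ∅`, `s = 0`. [cite: Rogawski1990, §12.3 p. 178] -/
theorem HInfExt.ofCptRows_empty : HInfExt.ofCptRows L ι (fun _ => ∅) (fun _ _ => 0) = HInfExt.xiOnly L ι := rfl

/-- Read-back: a compact exponent vector `κ` is licensed by `ofCptRows R s` iff `κ w ∈ R w` at every compact place. [cite: Rogawski1990, §14.4 Prop. 14.4.2 p. 236] -/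
theorem HInfExt.licensed_ofCptRows_iff (κ : CptPlace L ι → ℤ × ℤ) :
    (∀ w, κ w ∈ (HInfExt.ofCptRows L ι R s).cptLab w) ↔ ∀ w, κ w ∈ R w := Iff.rfl

/-! ## §2 The law-shares of `ofCptRows` (and of `xiOnly`) are vacuous [§13.3 p. 203; §12.3 Prop. 12.3.3 p. 178; §14.4 Prop. 14.4.2 p. 236] -/

variable (νHi : @Measure (UnitaryGroup.arch (↥(maximalRealSubfield L)) L (IsCMField.complexConj L) 2 (F0P3InnerFormClassificationV6.splitForm L 2) ×
  UnitaryGroup.arch (↥(maximalRealSubfield L)) L (IsCMField.complexConj L) 1 (F0P3InnerFormClassificationV6.splitForm L 1)) (borel _))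

/-- `(ofCptRows R s).LawKH5` holds (no extension token). [cite: Rogawski1990, §13.3 p. 203] -/
theorem HInfExt.ofCptRows_lawKH5 : (HInfExt.ofCptRows L ι R s).LawKH5 L ι νHi := fun t => nomatch t

/-- `(ofCptRows R s).LawKT3 …` holds (no extension label): the (KT3) identity restricted to the labels `(ext r, κ)` quantifies over `r : PEmpty`.  Binders spelled
verbatim as ★ `HInfExt.LawKT3`. [cite: Rogawski1990, §12.3 Prop. 12.3.3 p. 178; §14.4 Prop. 14.4.2 p. 236] -/
theorem HInfExt.ofCptRows_lawKT3 (H : Matrix (Fin 3) (Fin 3) L) (μω : HeckeCharacter L) (Tinf : ArchTransferFactor L H)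
    (mHi : letI : ∀ a : UnitaryGroup.arch (↥(maximalRealSubfield L)) L (IsCMField.complexConj L) 2 (F0P3InnerFormClassificationV6.splitForm L 2) × UnitaryGroup.arch (↥(maximalRealSubfield L)) L (IsCMField.complexConj L) 1 (F0P3InnerFormClassificationV6.splitForm L 1), MeasurableSpace ((UnitaryGroup.arch (↥(maximalRealSubfield L)) L (IsCMField.complexConj L) 2 (F0P3InnerFormClassificationV6.splitForm L 2) × UnitaryGroup.arch (↥(maximalRealSubfield L)) L (IsCMField.complexConj L) 1 (F0P3InnerFormClassificationV6.splitForm L 1)) ⧸ Subgroup.centralizer ({a} : Set (UnitaryGroup.arch (↥(maximalRealSubfield L)) L (IsCMField.complexConj L) 2 (F0P3InnerFormClassificationV6.splitForm L 2) × UnitaryGroup.arch (↥(maximalRealSubfield L)) L (IsCMField.complexConj L) 1 (F0P3InnerFormClassificationV6.splitForm L 1)))) := fun _ => borel _;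
      OrbitalMeasureFamily (UnitaryGroup.arch (↥(maximalRealSubfield L)) L (IsCMField.complexConj L) 2 (F0P3InnerFormClassificationV6.splitForm L 2) × UnitaryGroup.arch (↥(maximalRealSubfield L)) L (IsCMField.complexConj L) 1 (F0P3InnerFormClassificationV6.splitForm L 1)))
    (mGi : letI : ∀ γ : UnitaryGroup.arch (↥(maximalRealSubfield L)) L (IsCMField.complexConj L) 3 H, MeasurableSpace (UnitaryGroup.arch (↥(maximalRealSubfield L)) L (IsCMField.complexConj L) 3 H ⧸ Subgroup.centralizer ({γ} : Set (UnitaryGroup.arch (↥(maximalRealSubfield L)) L (IsCMField.complexConj L) 3 H))) := fun _ => borel _;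
      OrbitalMeasureFamily (UnitaryGroup.arch (↥(maximalRealSubfield L)) L (IsCMField.complexConj L) 3 H))
    (archTr' : Cinf → (UnitaryGroup.arch (↥(maximalRealSubfield L)) L (IsCMField.complexConj L) 3 H → ℂ) → ℂ) :
    (HInfExt.ofCptRows L ι R s).LawKT3 L ι H μω Tinf mHi mGi νHi archTr' := fun r => nomatch r

/-- `xiOnly.LawKT3 …` holds (no extension label) — the (KT3) twin of ★ `HInfExt.xiOnly_lawKH5`.  Binders spelled verbatim as ★ `HInfExt.LawKT3`.
[cite: Rogawski1990, §12.3 Prop. 12.3.3 p. 178; §14.4 Prop. 14.4.2 p. 236] -/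
theorem HInfExt.xiOnly_lawKT3 (H : Matrix (Fin 3) (Fin 3) L) (μω : HeckeCharacter L) (Tinf : ArchTransferFactor L H)
    (mHi : letI : ∀ a : UnitaryGroup.arch (↥(maximalRealSubfield L)) L (IsCMField.complexConj L) 2 (F0P3InnerFormClassificationV6.splitForm L 2) × UnitaryGroup.arch (↥(maximalRealSubfield L)) L (IsCMField.complexConj L) 1 (F0P3InnerFormClassificationV6.splitForm L 1), MeasurableSpace ((UnitaryGroup.arch (↥(maximalRealSubfield L)) L (IsCMField.complexConj L) 2 (F0P3InnerFormClassificationV6.splitForm L 2) × UnitaryGroup.arch (↥(maximalRealSubfield L)) L (IsCMField.complexConj L) 1 (F0P3InnerFormClassificationV6.splitForm L 1)) ⧸ Subgroup.centralizer ({a} : Set (UnitaryGroup.arch (↥(maximalRealSubfield L)) L (IsCMField.complexConj L) 2 (F0P3InnerFormClassificationV6.splitForm L 2) × UnitaryGroup.arch (↥(maximalRealSubfield L)) L (IsCMField.complexConj L) 1 (F0P3InnerFormClassificationV6.splitForm L 1)))) := fun _ => borel _;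
      OrbitalMeasureFamily (UnitaryGroup.arch (↥(maximalRealSubfield L)) L (IsCMField.complexConj L) 2 (F0P3InnerFormClassificationV6.splitForm L 2) × UnitaryGroup.arch (↥(maximalRealSubfield L)) L (IsCMField.complexConj L) 1 (F0P3InnerFormClassificationV6.splitForm L 1)))
    (mGi : letI : ∀ γ : UnitaryGroup.arch (↥(maximalRealSubfield L)) L (IsCMField.complexConj L) 3 H, MeasurableSpace (UnitaryGroup.arch (↥(maximalRealSubfield L)) L (IsCMField.complexConj L) 3 H ⧸ Subgroup.centralizer ({γ} : Set (UnitaryGroup.arch (↥(maximalRealSubfield L)) L (IsCMField.complexConj L) 3 H))) := fun _ => borel _;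
      OrbitalMeasureFamily (UnitaryGroup.arch (↥(maximalRealSubfield L)) L (IsCMField.complexConj L) 3 H))
    (archTr' : Cinf → (UnitaryGroup.arch (↥(maximalRealSubfield L)) L (IsCMField.complexConj L) 3 H → ℂ) → ℂ) :
    (HInfExt.xiOnly L ι).LawKT3 L ι H μω Tinf mHi mGi νHi archTr' := fun r => nomatch r

/-! ## §3 The on-path emptiness certificate for `xiOnly` (RULING S2-R15 FACT) [§14.4 p. 236; §14.6 p. 244] -/

/-- **`#(CptPlace L ι) = N₀ = nCompactOfRecord L = [L⁺ : ℚ] − 1`** (★ `nCompactOfRecord_eq_card_ne_infinitePlace`; `CptPlace L ι` is that subtype).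
[cite: Rogawski1990, §14.6 p. 244] -/
theorem card_cptPlace : Fintype.card (CptPlace L ι) = nCompactOfRecord L := by
  rw [nCompactOfRecord_eq_card_ne_infinitePlace L ι]

/-- A second infinite place of `L` gives a compact place. [cite: Rogawski1990, §14.4 p. 236] -/
theorem nonempty_cptPlace_of_one_lt_card (h : 1 < Fintype.card (InfinitePlace L)) : Nonempty (CptPlace L ι) := by
  obtain ⟨w, hw⟩ := Fintype.exists_ne_of_one_lt_card h (InfinitePlace.mk ι)
  exact ⟨⟨w, hw⟩⟩

/-- **At the letters' frames (`h2 : 2 ≤ [L⁺ : ℚ]`; a fortiori on the h413 path, `h3 : 3 ≤ [L⁺ : ℚ]`, R-QS1-7) there IS a compact place** (★ `one_le_nCompactOfRecord`).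
[cite: Rogawski1990, §14.6 p. 244; §14.2 p. 233] -/
theorem nonempty_cptPlace_of_two_le_finrank (h2 : 2 ≤ Module.finrank ℚ ↥(maximalRealSubfield L)) : Nonempty (CptPlace L ι) := by
  rw [← Fintype.card_pos_iff, card_cptPlace]
  exact one_le_nCompactOfRecord L h2

/-- `xiOnly` licenses NO compact exponent vector as soon as there is a compact place (★ `isEmpty_cptPlace_of_licensed_xiOnly`, contrapositive).
[cite: Rogawski1990, §14.4 p. 236] -/
theorem isEmpty_licensed_xiOnly [h : Nonempty (CptPlace L ι)] :
    IsEmpty {κ : CptPlace L ι → ℤ × ℤ // ∀ w, κ w ∈ (HInfExt.xiOnly L ι).cptLab w} :=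
  ⟨fun κ => (isEmpty_cptPlace_of_licensed_xiOnly L ι κ).false h.some⟩

/-- **S2-R15 FACT — `PktInfH (xiOnly)` IS EMPTY as soon as `CptPlace L ι` is non-empty**: `PktInfH L ι X = HLabIota X × {κ ∕∕ ∀ w, κ w ∈ X.cptLab w}` (★ :146) and
`xiOnly.cptLab w = ∅` (★ :130), so at `X := xiOnly` the `H_∞`-kit of record has NO packet and every packet law over it is vacuous. [cite: Rogawski1990, §14.4 p. 236; §12.3 p. 176] -/
theorem isEmpty_pktInfH_xiOnly [Nonempty (CptPlace L ι)] : IsEmpty (PktInfH L ι (HInfExt.xiOnly L ι)) :=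
  ⟨fun P => (isEmpty_licensed_xiOnly L ι).false P.2⟩

/-- **ON PATH (`2 ≤ [L⁺ : ℚ]`, a fortiori `h3 : 3 ≤ [L⁺ : ℚ]`) the `xiOnly`-kit has no `H_∞`-packet.** [cite: Rogawski1990, §14.4 p. 236; §14.6 p. 244] -/
theorem isEmpty_pktInfH_xiOnly_of_two_le_finrank (h2 : 2 ≤ Module.finrank ℚ ↥(maximalRealSubfield L)) :
    IsEmpty (PktInfH L ι (HInfExt.xiOnly L ι)) :=
  haveI := nonempty_cptPlace_of_two_le_finrank L ι h2
  isEmpty_pktInfH_xiOnly L ι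

/-- **R-QS1-7 TOKEN FORM (Q-S1 OF RECORD: `h3 : 3 ≤ [L⁺ : ℚ]` on the h413 path): the `xiOnly`-kit has no `H_∞`-packet on path.**
[cite: Rogawski1990, §14.4 p. 236; §14.6 p. 244] -/
theorem isEmpty_pktInfH_xiOnly_of_three_le_finrank (h3 : 3 ≤ Module.finrank ℚ ↥(maximalRealSubfield L)) :
    IsEmpty (PktInfH L ι (HInfExt.xiOnly L ι)) :=
  isEmpty_pktInfH_xiOnly_of_two_le_finrank L ι (Nat.le_of_succ_le h3)

/-- Kit-level form: the packet carrier of ★ `rogawskiArchKitH L ι H μω xiOnly` is empty as soon as there is a compact place (★ `rogawskiArchKitH_PktInfH`, `rfl`).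
[cite: Rogawski1990, §14.4 p. 236; §12.3 p. 178] -/
theorem isEmpty_pktInfH_rogawskiArchKitH_xiOnly [Nonempty (CptPlace L ι)] (H : Matrix (Fin 3) (Fin 3) L) (μω : HeckeCharacter L) :
    IsEmpty (rogawskiArchKitH L ι H μω (HInfExt.xiOnly L ι)).PktInfH :=
  isEmpty_pktInfH_xiOnly L ι

/-! ## §4 Non-emptiness for licensed rows [§14.4 Prop. 14.4.2 p. 236; §13.3 Thm. 13.3.7 p. 203] -/

/-- Licensing a non-empty row at EVERY compact place gives a licensed compact exponent vector (a choice of one licensed pair per place).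
[cite: Rogawski1990, §14.4 Prop. 14.4.2 p. 236] -/
theorem nonempty_licensed_ofCptRows (hR : ∀ w, (R w).Nonempty) :
    Nonempty {κ : CptPlace L ι → ℤ × ℤ // ∀ w, κ w ∈ (HInfExt.ofCptRows L ι R s).cptLab w} :=
  ⟨⟨fun w => (hR w).choose, fun w => (hR w).choose_spec⟩⟩

/-- **`PktInfH (ofCptRows R s)` IS NON-EMPTY when every compact place licenses a row**: witness the character packet `ξ_ι(0, 0) ⊗ (a licensed row at each `w`)` —
exactly the packets through which GLOBAL one-dimensional `ξ` enter (Thm. 13.3.7 ∕ 14.6.4). [cite: Rogawski1990, §13.3 Thm. 13.3.7 p. 203; §14.4 Prop. 14.4.2 p. 236] -/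
theorem nonempty_pktInfH_ofCptRows (hR : ∀ w, (R w).Nonempty) : Nonempty (PktInfH L ι (HInfExt.ofCptRows L ι R s)) :=
  ⟨(HLabIota.xi 0 0, Classical.choice (nonempty_licensed_ofCptRows L ι R s hR))⟩

/-- **`PktInfH (ofCptRows R s)` is non-empty IFF every compact place licenses a row** (→: read the licensed vector of any packet; ←: ★ `nonempty_pktInfH_ofCptRows`).
[cite: Rogawski1990, §14.4 Prop. 14.4.2 p. 236; §13.3 Thm. 13.3.7 p. 203] -/
theorem nonempty_pktInfH_ofCptRows_iff : Nonempty (PktInfH L ι (HInfExt.ofCptRows L ι R s)) ↔ ∀ w, (R w).Nonempty :=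
  ⟨fun ⟨P⟩ w => ⟨P.2.1 w, P.2.2 w⟩, nonempty_pktInfH_ofCptRows L ι R s⟩

/-- Kit-level form of the non-emptiness (★ `rogawskiArchKitH_PktInfH`, `rfl`). [cite: Rogawski1990, §13.3 Thm. 13.3.7 p. 203; §12.3 p. 178] -/
theorem nonempty_pktInfH_rogawskiArchKitH_ofCptRows (hR : ∀ w, (R w).Nonempty) (H : Matrix (Fin 3) (Fin 3) L) (μω : HeckeCharacter L) :
    Nonempty (rogawskiArchKitH L ι H μω (HInfExt.ofCptRows L ι R s)).PktInfH :=
  nonempty_pktInfH_ofCptRows L ι R s hR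

/-- Converse: ONE compact place licensing nothing empties the kit (`κ w₀ ∈ ∅` is impossible). [cite: Rogawski1990, §14.4 Prop. 14.4.2 p. 236] -/
theorem isEmpty_pktInfH_ofCptRows_of_eq_empty (w₀ : CptPlace L ι) (h : R w₀ = ∅) : IsEmpty (PktInfH L ι (HInfExt.ofCptRows L ι R s)) :=
  ⟨fun P => by simpa [h] using P.2.2 w₀⟩

end Frame

end Summit.HodgeConjecture.HodgeConjecture.R90.S2

end
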